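import Literature.MathematicalPhysics.QuantumFieldTheory.Balaban1983to89.BlockAveragingExpMeanLog
import Summits.QuantumFields.YangMills.Theorems.BalabanUVNodesN16UniformScalarJensen
import HarnessLib

/-!
# YM-DAG node N16 (NE3), the re-keyed N07 in-edge — RANK `n`: THE WILSON WEIGHT OF A UNITARY PLAQUETTE VARIABLE AGAINST ITS DETERMINANT PHASE
# (`1 − Re tr W ∕ n ≥ 1 − cos(arg det W ∕ n)`, with rigidity), and the series logarithm of a unitary matrix near `1` (file A of the g7 piece)

Cell `pub-ymgap`, width seat `pub-ymgap-dag-n16-w2` (director-ym №197 ∕ HUMAN RULING D-0149), generation 7.  `--kind proof --supports stmt-QuantumFields-27366 --as helper`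
(K3⁸, KEY MAP v2).  `bears_on: R4∕N16`, edge N07 → N16.  COUNT-NEUTRAL.

HONEST FRAMING.  Exact finite-dimensional matrix analysis (Liouville's formula `det e^X = e^{tr X}` — tree `Literature.Analysis.Matrix.det_exp_eq_exp_trace`; the
Hermitian spectral theorem — Mathlib `Matrix.IsHermitian.spectral_theorem`; Jensen for the strictly concave `cos` on `[−π∕2, π∕2]` — g6 file 6a `jensen_one_sub_cos`).  It is the
per-plaquette input of the RANK-`n` extension (files B `…N16DetTransport`, C `…N16RankNUniformScalarMinimisers`) of g6's rank-one minimiser picture on the uniform-curvature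
scalar data.  Nothing of Bałaban is asserted or refuted; DischargeTest `stub_reg910Slot` NOT closed; no K3⁸ v6 stub named or closed; N16 ∕ N07 NOT discharged; counts UNMOVED
(typed 28∕28 · discharged 5∕27 · A 5∕28).  R4 closes the conditional finite-𝕋⁴ rung `BalabanLadder.UV` only; NOT ℝ⁴ ∕ OS ∕ mass gap; the YM mass gap (Clay) is NOT proved by any
of this.

WHAT IS PROVED ([folklore], 0 `sorry`, 0 `def`).  Throughout `W ∈ U(n)` (the `L²`-operator norm on `M_n(ℂ)`), the GUARD is `‖W − 1‖ ≤ 1∕3` (inside the domain of the series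
logarithm (21) `log W = mlog W`, where `log ∘ exp = id`), and the DETERMINANT PHASE of `W` is `τ(W) := Im tr log W` (written out; no definition is introduced).
§1 `exists_isHermitian_mlog_eq` (`log W = iA`, `A` Hermitian, `‖A‖ ≤ (π∕2)‖W − 1‖`), `trace_mlog_eq_tau_mul_I` (`tr log W = iτ(W)`), `det_eq_cexp_trace_mlog` ∕ ★ `det_eq_cexp_tau`
(`det W = e^{tr log W} = e^{iτ(W)}` — Liouville), `abs_tau_le` (`|τ(W)| ≤ 2·n·‖W − 1‖`), `norm_det_sub_one_le` (`|det W − 1| ≤ 2·n·‖W − 1‖`), `tau_cexp_smul_one`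
(`τ(e^{if}·1) = n·f` for `|f| < ln 2`), `det_cexp_smul_one` (`det(e^{if}·1) = e^{inf}`).
§2 `re_trace_exp_I_smul` (`Re tr e^{iA} = Σ_j cos λ_j(A)`), ★★ `one_sub_cos_tau_le_wt` (**`wt W = 1 − Re tr W∕n ≥ 1 − cos(τ(W)∕n)`** —
Jensen over the eigen-index), ★★ `eq_smul_one_of_wt_eq` (**RIGIDITY: equality forces `W = e^{iτ(W)∕n}·1`** — Jensen's equality case makes all eigenangles equal, so `A` is
scalar), `eq_one_of_wt_eq_zero` (`wt W = 0 ⟹ W = 1` on the guard), `abs_tau_div_le` (`|τ(W)∕n| ≤ (π∕2)‖W − 1‖ ≤ π∕6`).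

DEPENDENCES (by name): `MatrixLog` (`mlog`, `exp_mlog`, `norm_mlog_le_two_mul`, `exists_isHermitian_exp_eq`); `B7BlockAvgLog.mlog_exp`; `ExpMeanLog` (`star_mlog_eq_neg`,
`norm_mlog_lt_log_two`); `Literature.Analysis.Matrix.det_exp_eq_exp_trace`; `MatrixNorms.norm_ntr_le_opNorm` ((20): `|tr X| ≤ n‖X‖`); `UnitaryModel` (`nReTr`, `opDist1`); `T4AveragingDeficitWall.wt`;
`T4AveragingDeficitWallBoundary.mlog_exp_smul_one`; `FederbushMean` (`cexp_smul_one`, `norm_smul_one_eq`); g6 file 6a (`jensen_one_sub_cos`, `jensen_one_sub_cos_eq_iff`); Mathlib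
(`Matrix.IsHermitian.spectral_theorem`, `.trace_eq_sum_eigenvalues`, `.eigenvalues_mem_spectrum_real`, `spectrum.norm_le_norm_of_mem`, `Matrix.exp_units_conj`, `Matrix.exp_diagonal`,
`Pi.coe_exp`, `Matrix.trace_units_conj`, `Real.norm_exp_I_mul_ofReal_sub_one_le`, `Real.cos_eq_one_iff_of_lt_of_lt`).
-/

open scoped BigOperators Matrix Matrix.Norms.L2Operator
open NormedSpace Finset

namespace Summit.QuantumFields.YangMills.BalabanUVNodes.N16RankNWilsonWeightDetPhase

open Literature.MathematicalPhysics.QuantumFieldTheory.Balaban1983to89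
open B7Prop1Explicit B7Prop2Explicit MatrixLog UnitaryModel
open T4AveragingDeficitWall (wt)
open T4AveragingDeficitWallBoundary (mlog_exp_smul_one)
open FederbushMean (cexp_smul_one norm_smul_one_eq)
open ExpMeanLog (star_mlog_eq_neg norm_mlog_lt_log_two)
open Literature.Analysis.Matrix (det_exp_eq_exp_trace)
open Summit.QuantumFields.YangMills.BalabanUVNodes.N16UniformScalarJensen (jensen_one_sub_cos jensen_one_sub_cos_eq_iff)

noncomputable section

variable {n : Type} [Fintype n] [DecidableEq n]

/-! ## §1 The series logarithm of a unitary matrix near `1`: `log W = iA`, `tr log W = iτ(W)`, `det W = e^{iτ(W)}` -/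

/-- **`log W = iA` with `A` Hermitian and `‖A‖ ≤ (π∕2)‖W − 1‖`** for `W ∈ U(n)` with `‖W − 1‖ ≤ 1∕3`: the principal logarithm (23) of `MatrixLog.exists_isHermitian_exp_eq` is the
series logarithm (21) there (`log ∘ exp = id` on `‖·‖ < ln 2`, and `(π∕2)·(1∕3) < ln 2`). [cite: Balaban1985Averaging, (21)–(25) p.21] -/
theorem exists_isHermitian_mlog_eq {W : Matrix n n ℂ} (hW : W ∈ Matrix.unitaryGroup n ℂ) (hs : ‖W - 1‖ ≤ 1 / 3) :
    ∃ A : Matrix n n ℂ, A.IsHermitian ∧ mlog W = Complex.I • A ∧ ‖A‖ ≤ Real.pi / 2 * ‖W - 1‖ := by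
  obtain ⟨A, hA, -, hexp, -, hle⟩ := exists_isHermitian_exp_eq hW
  refine ⟨A, hA, ?_, by simpa [opDist1] using hle⟩
  rw [← hexp]
  apply B7BlockAvgLog.mlog_exp
  have hπ : Real.pi < 3.15 := Real.pi_lt_d2
  have hl2 : (0.6931471803 : ℝ) < Real.log 2 := Real.log_two_gt_d9
  calc ‖Complex.I • A‖ = ‖A‖ := by rw [norm_smul, Complex.norm_I, one_mul]
    _ ≤ Real.pi / 2 * ‖W - 1‖ := by simpa [opDist1] using hle
    _ ≤ Real.pi / 2 * (1 / 3) := by gcongr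
    _ < Real.log 2 := by linarith

/-- `Re tr log W = 0` for `W ∈ U(n)`, `‖W − 1‖ ≤ 1∕3` (`log W` is skew-Hermitian: `ExpMeanLog.star_mlog_eq_neg`). [folklore] -/
theorem trace_mlog_re {W : Matrix n n ℂ} (hW : W ∈ Matrix.unitaryGroup n ℂ) (hs : ‖W - 1‖ ≤ 1 / 3) : ((mlog W).trace).re = 0 := by
  have h := congrArg Matrix.trace (star_mlog_eq_neg hW hs)
  rw [Matrix.star_eq_conjTranspose, Matrix.trace_conjTranspose, Matrix.trace_neg] at h
  have hre := congrArg Complex.re h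
  rw [Complex.star_def, Complex.conj_re, Complex.neg_re] at hre
  linarith

/-- **`tr log W = i·τ(W)`**, `τ(W) := Im tr log W` (the determinant phase), for `W ∈ U(n)`, `‖W − 1‖ ≤ 1∕3`. [folklore] -/
theorem trace_mlog_eq_tau_mul_I {W : Matrix n n ℂ} (hW : W ∈ Matrix.unitaryGroup n ℂ) (hs : ‖W - 1‖ ≤ 1 / 3) :
    (mlog W).trace = (((mlog W).trace.im : ℝ) : ℂ) * Complex.I := by
  apply Complex.ext
  · simp [trace_mlog_re hW hs]
  · simp

/-- **Liouville through the series logarithm**: `det W = e^{tr log W}` whenever `‖W − 1‖ < 1` (`det e^{log W} = e^{tr log W}`, `e^{log W} = W`). [folklore] -/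
theorem det_eq_cexp_trace_mlog {W : Matrix n n ℂ} (hs : ‖W - 1‖ < 1) : W.det = Complex.exp (mlog W).trace := by
  rw [Complex.exp_eq_exp_ℂ, ← det_exp_eq_exp_trace, exp_mlog hs]

/-- **★ `det W = e^{iτ(W)}`** for `W ∈ U(n)`, `‖W − 1‖ ≤ 1∕3`: the determinant phase is a logarithm of `det W`. [folklore] -/
theorem det_eq_cexp_tau {W : Matrix n n ℂ} (hW : W ∈ Matrix.unitaryGroup n ℂ) (hs : ‖W - 1‖ ≤ 1 / 3) :
    W.det = Complex.exp ((((mlog W).trace.im : ℝ) : ℂ) * Complex.I) := by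
  rw [det_eq_cexp_trace_mlog (hs.trans_lt (by norm_num))]
  conv_lhs => rw [trace_mlog_eq_tau_mul_I hW hs]

/-- **`|τ(W)| ≤ 2·n·‖W − 1‖`** for `‖W − 1‖ ≤ 1∕2` ((20) and (26): `|Im tr log W| ≤ |tr log W| ≤ n‖log W‖ ≤ 2n‖W − 1‖`). [cite: Balaban1985Averaging, (20) p.21, (26) p.22] -/
theorem abs_tau_le {W : Matrix n n ℂ} (hs : ‖W - 1‖ ≤ 1 / 2) : |(mlog W).trace.im| ≤ 2 * Fintype.card n * ‖W - 1‖ := by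
  have h1 : |(mlog W).trace.im| ≤ ‖(mlog W).trace‖ := Complex.abs_im_le_norm _
  -- `|tr M| ≤ n‖M‖` (B7 (20) for the normalised trace, `MatrixNorms.norm_ntr_le_opNorm`; = the tree's `QuantumLattice.norm_trace_le_card_mul_norm`,
  -- whose Lee–Yang module is not imported here to keep the closure small — as in `ExpMeanLog.trace_mlog_eq_zero`)
  have h2 : ‖(mlog W).trace‖ ≤ Fintype.card n * ‖mlog W‖ := by
    rcases isEmpty_or_nonempty n with hn | hn
    · simp [Matrix.trace]
    have hc : (0 : ℝ) < Fintype.card n := Nat.cast_pos.mpr Fintype.card_pos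
    have h : ‖(mlog W).trace / (Fintype.card n : ℂ)‖ ≤ ‖mlog W‖ := MatrixNorms.norm_ntr_le_opNorm (mlog W)
    rw [norm_div, Complex.norm_natCast, div_le_iff₀ hc] at h
    linarith [mul_comm (Fintype.card n : ℝ) ‖mlog W‖]
  have h3 := norm_mlog_le_two_mul hs
  have hc : (0 : ℝ) ≤ Fintype.card n := Nat.cast_nonneg _
  nlinarith [mul_le_mul_of_nonneg_left h3 hc]

/-- **`|det W − 1| ≤ 2·n·‖W − 1‖`** for `W ∈ U(n)`, `‖W − 1‖ ≤ 1∕3` (`det W = e^{iτ}`, `|e^{iτ} − 1| ≤ |τ|`). [folklore] -/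
theorem norm_det_sub_one_le {W : Matrix n n ℂ} (hW : W ∈ Matrix.unitaryGroup n ℂ) (hs : ‖W - 1‖ ≤ 1 / 3) :
    ‖W.det - 1‖ ≤ 2 * Fintype.card n * ‖W - 1‖ := by
  rw [det_eq_cexp_tau hW hs, mul_comm]
  exact (Real.norm_exp_I_mul_ofReal_sub_one_le (x := (mlog W).trace.im)).trans
    ((Real.norm_eq_abs _).le.trans (abs_tau_le (hs.trans (by norm_num))))

/-- `τ(e^{if}·1) = n·f` for a real `f` with `|f| < ln 2` (`log e^{if·1} = if·1`, `tr 1 = n`). [folklore] -/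
theorem tau_cexp_smul_one [Nonempty n] {f : ℝ} (hf : |f| < Real.log 2) :
    (mlog (Complex.exp (((f : ℝ) : ℂ) * Complex.I) • (1 : Matrix n n ℂ))).trace.im = Fintype.card n * f := by
  rw [cexp_smul_one, mlog_exp_smul_one (by rw [norm_mul, Complex.norm_I, mul_one, Complex.norm_real, Real.norm_eq_abs]; exact hf),
    Matrix.trace_smul, Matrix.trace_one, smul_eq_mul]
  simp [mul_comm]

/-- `det(e^{if}·1) = e^{inf}`. [folklore] -/
theorem det_cexp_smul_one (f : ℝ) :
    (Complex.exp (((f : ℝ) : ℂ) * Complex.I) • (1 : Matrix n n ℂ)).det = Complex.exp ((((Fintype.card n * f : ℝ)) : ℂ) * Complex.I) := by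
  rw [Matrix.det_smul, Matrix.det_one, mul_one, ← Complex.exp_nat_mul]
  push_cast; ring_nf

/-! ## §2 The Wilson weight against the determinant phase: `wt W ≥ 1 − cos(τ(W)∕n)`, with rigidity -/

/-- **`Re tr e^{iA} = Σ_j cos λ_j(A)`** for a Hermitian `A` (spectral theorem: `A = U·diag(λ)·U⋆`, `e^{iA} = U·diag(e^{iλ_j})·U⋆`). [folklore] -/
theorem re_trace_exp_I_smul {A : Matrix n n ℂ} (hA : A.IsHermitian) :
    ((exp (Complex.I • A)).trace).re = ∑ j, Real.cos (hA.eigenvalues j) := by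
  letI : NormedAlgebra ℚ (Matrix n n ℂ) := NormedAlgebra.restrictScalars ℚ ℂ (Matrix n n ℂ)
  set U : (Matrix n n ℂ)ˣ := Unitary.toUnits hA.eigenvectorUnitary with hU
  set D : Matrix n n ℂ := Matrix.diagonal (RCLike.ofReal ∘ hA.eigenvalues) with hD
  have hUinv : ((U⁻¹ : (Matrix n n ℂ)ˣ) : Matrix n n ℂ) = star (hA.eigenvectorUnitary : Matrix n n ℂ) := rfl
  have hAconj : A = (U : Matrix n n ℂ) * D * ((U⁻¹ : (Matrix n n ℂ)ˣ) : Matrix n n ℂ) := by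
    rw [hUinv]
    conv_lhs => rw [hA.spectral_theorem]
    rw [Unitary.conjStarAlgAut_apply]
    rfl
  have hIA : Complex.I • A = (U : Matrix n n ℂ) * (Complex.I • D) * ((U⁻¹ : (Matrix n n ℂ)ˣ) : Matrix n n ℂ) := by
    rw [hAconj, Matrix.mul_smul, Matrix.smul_mul]
  rw [hIA, Matrix.exp_units_conj, Matrix.trace_units_conj, hD, ← Matrix.diagonal_smul, Matrix.exp_diagonal, Matrix.trace_diagonal,
    Complex.re_sum]
  refine Finset.sum_congr rfl fun j _ => ?_
  rw [Pi.coe_exp, Pi.smul_apply, Function.comp_apply, smul_eq_mul, ← Complex.exp_eq_exp_ℂ]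
  show (Complex.exp (Complex.I * ((hA.eigenvalues j : ℝ) : ℂ))).re = _
  rw [mul_comm, Complex.exp_ofReal_mul_I_re]

/-- **★★ THE WILSON WEIGHT DOMINATES THE DETERMINANT PHASE**: for `W ∈ U(n)` with `‖W − 1‖ ≤ 1∕3`, `wt W = 1 − Re tr W∕n ≥ 1 − cos(τ(W)∕n)` — with `log W = iA`,
`Re tr W = Σ_j cos λ_j`, `τ(W) = Σ_j λ_j`, `|λ_j| ≤ ‖A‖ ≤ π∕6`, and Jensen for the concave `cos` over the eigen-index. [cite: Balaban1985Variational, (5) p.278] -/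
theorem one_sub_cos_tau_le_wt [Nonempty n] {W : (Matrix n n ℂ)ˣ} (hW : W ∈ unitaryUnits (Matrix n n ℂ)) (hs : ‖(W : Matrix n n ℂ) - 1‖ ≤ 1 / 3) :
    1 - Real.cos ((mlog (W : Matrix n n ℂ)).trace.im / Fintype.card n) ≤ wt W := by
  have hWu : (W : Matrix n n ℂ) ∈ Matrix.unitaryGroup n ℂ := mem_unitaryUnits.mp hW
  obtain ⟨A, hA, hlog, hAle⟩ := exists_isHermitian_mlog_eq hWu hs
  have hexp : (W : Matrix n n ℂ) = exp (Complex.I • A) := by rw [← hlog, exp_mlog (hs.trans_lt (by norm_num))]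
  have hc : (0 : ℝ) < Fintype.card n := Nat.cast_pos.mpr Fintype.card_pos
  -- `τ = Σ λ_j`
  have htau : (mlog (W : Matrix n n ℂ)).trace.im = ∑ j, hA.eigenvalues j := by
    rw [hlog, Matrix.trace_smul, hA.trace_eq_sum_eigenvalues, smul_eq_mul, Complex.mul_im, Complex.I_re, Complex.I_im]
    simp [Complex.im_sum, Complex.re_sum]
  -- `wt W = (1/n) Σ (1 − cos λ_j)`
  have hwt : wt W = (∑ j, (1 - Real.cos (hA.eigenvalues j))) / Fintype.card n := by
    rw [wt, nReTr, hexp, re_trace_exp_I_smul hA, Finset.sum_sub_distrib, Finset.sum_const, Finset.card_univ, nsmul_eq_mul, mul_one]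
    field_simp
  -- the eigenangles are in `[−π/2, π/2]`
  -- `|λ_j| ≤ ‖A‖` (eigenvalues lie in the spectrum, which the norm bounds; = the tree's `QuantumLattice.KomaTasaki.abs_eigenvalues_le_norm`, whose module is not
  -- imported here to keep the closure small)
  have hev : ∀ j, |hA.eigenvalues j| ≤ ‖A‖ := fun j => by
    have h2 : ((hA.eigenvalues j : ℝ) : ℂ) ∈ spectrum ℂ A := by
      have h := hA.eigenvalues_mem_spectrum_real j
      rw [← spectrum.algebraMap_mem_iff ℂ] at h
      exact h
    have h3 := spectrum.norm_le_norm_of_mem h2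
    rwa [Complex.norm_real, Real.norm_eq_abs] at h3
  have hθ : ∀ j ∈ (Finset.univ : Finset n), |hA.eigenvalues j| ≤ Real.pi / 2 := by
    intro j _
    refine (hev j).trans (hAle.trans ?_)
    have hπ : 0 < Real.pi := Real.pi_pos
    nlinarith
  have hJ := jensen_one_sub_cos (Finset.univ : Finset n) Finset.univ_nonempty (fun j => hA.eigenvalues j) hθ
  rw [Finset.card_univ] at hJ
  rw [hwt, htau, le_div_iff₀ hc, mul_comm]
  exact hJ

/-- **★★ RIGIDITY**: if `wt W = 1 − cos(τ(W)∕n)` for `W ∈ U(n)` with `‖W − 1‖ ≤ 1∕3`, then `W = e^{iτ(W)∕n}·1` is the SCALAR with that determinant phase (Jensen's equality case: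
all eigenangles of `A = −i log W` coincide, so `A = (τ∕n)·1`). [folklore] -/
theorem eq_smul_one_of_wt_eq [Nonempty n] {W : (Matrix n n ℂ)ˣ} (hW : W ∈ unitaryUnits (Matrix n n ℂ)) (hs : ‖(W : Matrix n n ℂ) - 1‖ ≤ 1 / 3)
    (heq : wt W = 1 - Real.cos ((mlog (W : Matrix n n ℂ)).trace.im / Fintype.card n)) :
    (W : Matrix n n ℂ) = Complex.exp (((((mlog (W : Matrix n n ℂ)).trace.im / Fintype.card n : ℝ)) : ℂ) * Complex.I) • (1 : Matrix n n ℂ) := by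
  letI : NormedAlgebra ℚ (Matrix n n ℂ) := NormedAlgebra.restrictScalars ℚ ℂ (Matrix n n ℂ)
  have hWu : (W : Matrix n n ℂ) ∈ Matrix.unitaryGroup n ℂ := mem_unitaryUnits.mp hW
  obtain ⟨A, hA, hlog, hAle⟩ := exists_isHermitian_mlog_eq hWu hs
  have hexp : (W : Matrix n n ℂ) = exp (Complex.I • A) := by rw [← hlog, exp_mlog (hs.trans_lt (by norm_num))]
  have hc : (0 : ℝ) < Fintype.card n := Nat.cast_pos.mpr Fintype.card_pos
  have htau : (mlog (W : Matrix n n ℂ)).trace.im = ∑ j, hA.eigenvalues j := by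
    rw [hlog, Matrix.trace_smul, hA.trace_eq_sum_eigenvalues, smul_eq_mul, Complex.mul_im, Complex.I_re, Complex.I_im]
    simp [Complex.im_sum, Complex.re_sum]
  have hwt : wt W = (∑ j, (1 - Real.cos (hA.eigenvalues j))) / Fintype.card n := by
    rw [wt, nReTr, hexp, re_trace_exp_I_smul hA, Finset.sum_sub_distrib, Finset.sum_const, Finset.card_univ, nsmul_eq_mul, mul_one]
    field_simp
  -- `|λ_j| ≤ ‖A‖` (eigenvalues lie in the spectrum, which the norm bounds; = the tree's `QuantumLattice.KomaTasaki.abs_eigenvalues_le_norm`, whose module is not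
  -- imported here to keep the closure small)
  have hev : ∀ j, |hA.eigenvalues j| ≤ ‖A‖ := fun j => by
    have h2 : ((hA.eigenvalues j : ℝ) : ℂ) ∈ spectrum ℂ A := by
      have h := hA.eigenvalues_mem_spectrum_real j
      rw [← spectrum.algebraMap_mem_iff ℂ] at h
      exact h
    have h3 := spectrum.norm_le_norm_of_mem h2
    rwa [Complex.norm_real, Real.norm_eq_abs] at h3
  have hθ : ∀ j ∈ (Finset.univ : Finset n), |hA.eigenvalues j| ≤ Real.pi / 2 := by
    intro j _
    refine (hev j).trans (hAle.trans ?_)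
    have hπ : 0 < Real.pi := Real.pi_pos
    nlinarith
  -- Jensen's equality case: every eigenvalue equals the mean `τ/n`
  have heq' : ∑ j ∈ (Finset.univ : Finset n), (1 - Real.cos (hA.eigenvalues j))
      = ((Finset.univ : Finset n).card : ℝ) * (1 - Real.cos ((∑ j ∈ (Finset.univ : Finset n), hA.eigenvalues j) / (Finset.univ : Finset n).card)) := by
    rw [Finset.card_univ, ← htau]
    have := heq
    rw [hwt, div_eq_iff hc.ne'] at this
    linarith
  have hall := jensen_one_sub_cos_eq_iff (Finset.univ : Finset n) Finset.univ_nonempty (fun j => hA.eigenvalues j) hθ heq'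
  rw [Finset.card_univ, ← htau] at hall
  set t : ℝ := (mlog (W : Matrix n n ℂ)).trace.im / Fintype.card n with ht
  -- hence `diag(λ) = t·1`, `A = t·1`, `W = e^{it}·1`
  have hD : Matrix.diagonal (RCLike.ofReal ∘ hA.eigenvalues) = ((t : ℝ) : ℂ) • (1 : Matrix n n ℂ) := by
    have : (RCLike.ofReal ∘ hA.eigenvalues : n → ℂ) = fun _ => ((t : ℝ) : ℂ) := by
      funext j
      show ((hA.eigenvalues j : ℝ) : ℂ) = _
      rw [hall j (Finset.mem_univ j)]
    rw [this]
    ext i j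
    by_cases hij : i = j
    · subst hij; simp
    · simp [hij]
  have hAt : A = ((t : ℝ) : ℂ) • (1 : Matrix n n ℂ) := by
    conv_lhs => rw [hA.spectral_theorem]
    rw [hD, map_smul, map_one]
  rw [hexp, hAt, smul_smul, cexp_smul_one, mul_comm]

/-- **`wt W = 0 ⟹ W = 1`** for `W ∈ U(n)` with `‖W − 1‖ ≤ 1∕3`: `0 = wt W ≥ 1 − cos(τ∕n) ≥ 0` forces `cos(τ∕n) = 1`, `τ∕n = 0` (`|τ∕n| ≤ π∕6`), and rigidity gives
`W = e^{0}·1`. [folklore] -/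
theorem eq_one_of_wt_eq_zero [Nonempty n] {W : (Matrix n n ℂ)ˣ} (hW : W ∈ unitaryUnits (Matrix n n ℂ)) (hs : ‖(W : Matrix n n ℂ) - 1‖ ≤ 1 / 3) (h0 : wt W = 0) :
    W = 1 := by
  have hWu : (W : Matrix n n ℂ) ∈ Matrix.unitaryGroup n ℂ := mem_unitaryUnits.mp hW
  have hc : (0 : ℝ) < Fintype.card n := Nat.cast_pos.mpr Fintype.card_pos
  set t : ℝ := (mlog (W : Matrix n n ℂ)).trace.im / Fintype.card n with ht
  have hge := one_sub_cos_tau_le_wt hW hs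
  rw [h0] at hge
  have hcos1 : Real.cos t = 1 := le_antisymm (Real.cos_le_one t) (by rw [← ht] at hge; linarith)
  -- `|t| ≤ 2‖W − 1‖ ≤ 2/3 < 2π`
  have htabs : |t| ≤ 2 * ‖(W : Matrix n n ℂ) - 1‖ := by
    rw [ht, abs_div, abs_of_pos hc, div_le_iff₀ hc]
    have := abs_tau_le (W := (W : Matrix n n ℂ)) (hs.trans (by norm_num))
    linarith
  have hπ : (3 : ℝ) < Real.pi := Real.pi_gt_three
  have htb := abs_le.mp htabs
  have ht0 : t = 0 := (Real.cos_eq_one_iff_of_lt_of_lt (by linarith) (by linarith)).mp hcos1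
  have hrig := eq_smul_one_of_wt_eq hW hs (by rw [h0, ← ht, hcos1, sub_self])
  rw [← ht, ht0] at hrig
  apply Units.ext
  rw [hrig, Units.val_one]
  simp

/-- **The normalised phase is small**: `|τ(W)∕n| ≤ 2‖W − 1‖` for `‖W − 1‖ ≤ 1∕2` (so `≤ π∕2` on the guard — the hypothesis of Jensen across plaquettes). [folklore] -/
theorem abs_tau_div_le [Nonempty n] {W : Matrix n n ℂ} (hs : ‖W - 1‖ ≤ 1 / 2) :
    |(mlog W).trace.im / Fintype.card n| ≤ 2 * ‖W - 1‖ := by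
  have hc : (0 : ℝ) < Fintype.card n := Nat.cast_pos.mpr Fintype.card_pos
  rw [abs_div, abs_of_pos hc, div_le_iff₀ hc]
  have := abs_tau_le (W := W) hs
  linarith

end

end Summit.QuantumFields.YangMills.BalabanUVNodes.N16RankNWilsonWeightDetPhase
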